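/-
Cell b2b-lgcu-borel (gen 25).  VALUE = THEOREM (a structure law for every member of every
hypothetical level-one witness, all primes `p ≥ 3`, all dimensions `m ≥ 2`), NOT summit progress;
the crux item `SubgroupIdentityDesigns` (stmt-MatrixMultiplication-14079) stays open and untouched.
-/
import Mathlib
import Summits.MatrixMultiplication.MatrixMultiplication.Theorems.SubgroupIdentityDesigns.Negative.LevelOneWindowAll

/-!
# The normal-Sylow law: a member's Sylow `p`-subgroup is normal (and the member reducible) or small

Route `LevelGradedCohnUmans`, crux `SubgroupIdentityDesigns` (stmt-MatrixMultiplication-14079), cells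
`(m, k) = (m, 1)`, `m = 1 + l ≥ 2`; report `run/shared/lean/b2b/levelgraded-cu/ORACLE-g25.md` §G25-2.

The `(2,1)` cell was organised by the Sylow `p`-subgroups of the members (`PMemberLaw`,
`TwoSylowLaw`, `ThreeSylowLaw`, …: Cauchy transvections and Borel frames in `GL₂`).  This file starts
the `p`-local analysis in EVERY dimension with two hypothesis-light facts.

1. **Sylow counting under the member window** (`card_mul_le_of_not_normal`, pure group theory): in a
   finite group `G`, a NON-normal Sylow `p`-subgroup `P` has at least `p + 1` conjugates, each
   inside its own normaliser coset count, so `(p + 1)·|P| ≤ |G|`.  The level-one MEMBER WINDOW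
   `|Hᵢ| ≤ p^m − 3` (`LevelOneWindowAll.levelOne_member_window`) then forces
   **`|P| ≤ p^{m−2}`, i.e. `|P|·p² ≤ p^m`, for every non-normal Sylow `p`-subgroup `P` of a member**
   (`crux_sylow₁/₂/₃`).  For `m = 3`: a member's Sylow `p`-subgroup is normal unless it has order
   `≤ p` (so `|Hᵢ|_p = p²` forces a normal Sylow; `|Hᵢ|_p = p³`, a full unitriangular group, is
   excluded outright by `RootChainFrames.no_design_of_cover_conj`).
2. **Normal `p`-subgroups make the member reducible** (`exists_invariant_of_normal_pGroup`, linear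
   algebra): if `H ≤ GL_m(𝔽_p)` normalises a non-trivial `p`-subgroup `N` then the common fixed space
   `Fix(N)` (`fixN`) is a PROPER NON-ZERO `H`-invariant subspace (non-zero by the `p`-group fixed-point
   theorem on `𝔽_p^m`, proper because `N ≠ 1`, invariant because `H` normalises `N`).  Hence a member
   with `p ∣ |Hᵢ|` and a normal Sylow `p`-subgroup lies in a proper parabolic
   (`crux_reducible₁/₂/₃`).

TRICHOTOMY (reading of 1 + 2).  Every member `H` of a level-one witness (`p ≥ 3`, `m ≥ 2`,
`−2 < ε ≤ 1`) is (Z) a `p′`-group, or (N) REDUCIBLE with a normal Sylow `p`-subgroup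
(`H ≤ N_{GL_m}(P) ≤ Stab(Fix P)`), or (S) has a NON-normal Sylow `p`-subgroup of order `≤ p^{m−2}`.
For `m = 3`, (S) means `|H|_p = p` with at least `p + 1` Sylow subgroups — the regime of `Ω₃(p)`,
`SL₂(p) ⊕ 1` (excluded by `CuspidalObstructionPlacements`) and the transvection-generated groups;
(N) is the parabolic regime `H ≤ P_ℓ` / `H ≤ P_W` of the affine-type candidates.

HONEST SCOPE.  Structure law only; it empties no `(p, m, ε)` cell.  Sorry-free; standard axioms.
-/

set_option linter.dupNamespace false

noncomputable section

open scoped BigOperators Classical Matrix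
open Module (finrank)

namespace Summit.MatrixMultiplication.MatrixMultiplication.Theorems.SubgroupIdentityDesigns.Negative
namespace NormalSylowLaw

open Summit.MatrixMultiplication.MatrixMultiplication.Theorems.LieRankDesigns.Negative (GLm Mat budget)
open Literature.Barriers.MatrixMultiplication (SubgroupTPP)
open LevelOneWindowAll (levelOne_member_window)

/-! ## 1. Sylow counting: a non-normal Sylow subgroup is small -/

section GroupTheory

variable {G : Type*} [Group G] [Finite G] {p : ℕ} [hp : Fact p.Prime]

/-- A non-normal Sylow `p`-subgroup has at least `p + 1` conjugates. -/
theorem succ_le_card_sylow_of_not_normal (P : Sylow p G) (hP : ¬ (P : Subgroup G).Normal) :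
    p + 1 ≤ Nat.card (Sylow p G) := by
  have hmod := card_sylow_modEq_one p G
  have hpos : 1 ≤ Nat.card (Sylow p G) := Nat.one_le_iff_ne_zero.mpr Nat.card_pos.ne'
  have hne : Nat.card (Sylow p G) ≠ 1 := by
    intro h1
    rw [P.card_eq_index_normalizer, Subgroup.index_eq_one] at h1
    exact hP (Subgroup.normalizer_eq_top_iff.mp h1)
  have hdvd : p ∣ Nat.card (Sylow p G) - 1 := (Nat.modEq_iff_dvd' hpos).mp hmod.symm
  have hle : p ≤ Nat.card (Sylow p G) - 1 := Nat.le_of_dvd (by omega) hdvd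
  omega

/-- **Sylow counting.**  If the Sylow `p`-subgroup `P` of the finite group `G` is not normal then
`(p + 1) · |P| ≤ |G|`. -/
theorem card_mul_le_of_not_normal (P : Sylow p G) (hP : ¬ (P : Subgroup G).Normal) :
    (p + 1) * Nat.card P ≤ Nat.card G := by
  have hn := succ_le_card_sylow_of_not_normal P hP
  have hidx : Nat.card (Sylow p G) = (Subgroup.normalizer ((P : Subgroup G) : Set G)).index :=
    P.card_eq_index_normalizer
  have hPN : Nat.card P ≤ Nat.card (Subgroup.normalizer ((P : Subgroup G) : Set G)) :=
    Subgroup.card_le_of_le Subgroup.le_normalizer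
  have hmul := (Subgroup.normalizer ((P : Subgroup G) : Set G)).card_mul_index
  calc (p + 1) * Nat.card P
      ≤ Nat.card (Sylow p G) * Nat.card (Subgroup.normalizer ((P : Subgroup G) : Set G)) :=
        Nat.mul_le_mul hn hPN
    _ = Nat.card G := by rw [hidx, mul_comm, hmul]

/-- **The window form.**  If `|G| < p^m` (e.g. `|G| + 3 ≤ p^m`, the level-one member window) then every
non-normal Sylow `p`-subgroup `P` of `G` has `|P| · p² ≤ p^m`, i.e. `|P| ≤ p^{m−2}`. -/
theorem card_sylow_mul_sq_le (P : Sylow p G) (hP : ¬ (P : Subgroup G).Normal) {m : ℕ}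
    (hG : Nat.card G < p ^ m) : Nat.card P * p ^ 2 ≤ p ^ m := by
  have h1 := card_mul_le_of_not_normal P hP
  have hcard : Nat.card P = p ^ (Nat.card G).factorization p := P.card_eq_multiplicity
  set a := (Nat.card G).factorization p
  have hp1 : 1 < p := hp.out.one_lt
  -- `p^{a+1} ≤ (p+1) p^a ≤ |G| < p^m`
  have hlt : p ^ (a + 1) < p ^ m := by
    have : p ^ (a + 1) ≤ (p + 1) * p ^ a := by rw [pow_succ, mul_comm]; gcongr; omega
    rw [hcard] at h1
    omega
  have ha : a + 2 ≤ m := by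
    have := (Nat.pow_lt_pow_iff_right hp1).mp hlt
    omega
  calc Nat.card P * p ^ 2 = p ^ (a + 2) := by rw [hcard, ← pow_add]
    _ ≤ p ^ m := Nat.pow_le_pow_right hp.out.pos ha

end GroupTheory

/-! ## 2. A normalised non-trivial `p`-subgroup has a proper non-zero invariant fixed space -/

section Fixed

variable {p m : ℕ} [hp : Fact p.Prime]

/-- The common fixed space `Fix(N) = {v | n v = v for all n ∈ N}` of a subgroup `N ≤ GL_m(𝔽_p)`. -/
def fixN (N : Subgroup (GLm p m)) : Submodule (ZMod p) (Fin m → ZMod p) where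
  carrier := {v | ∀ n ∈ N, (n : Mat p m) *ᵥ v = v}
  add_mem' := by
    intro a c ha hc n hn
    rw [Matrix.mulVec_add, ha n hn, hc n hn]
  zero_mem' := by
    intro n _
    exact Matrix.mulVec_zero _
  smul_mem' := by
    intro c v hv n hn
    rw [Matrix.mulVec_smul, hv n hn]

/-- Membership in the common fixed space. -/
theorem mem_fixN {N : Subgroup (GLm p m)} {v : Fin m → ZMod p} :
    v ∈ fixN N ↔ ∀ n ∈ N, (n : Mat p m) *ᵥ v = v :=
  Iff.rfl

/-- **Non-zero**: a `p`-subgroup of `GL_m(𝔽_p)` (`m ≥ 1`) fixes a non-zero vector (the `p`-group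
fixed-point theorem on `𝔽_p^m`, whose cardinality `p^m` is divisible by `p`, `0` being fixed). -/
theorem fixN_ne_bot (hm : 1 ≤ m) (N : Subgroup (GLm p m)) (hN : IsPGroup p N) : fixN N ≠ ⊥ := by
  have hcard : p ∣ Nat.card (Fin m → ZMod p) := by
    rw [Nat.card_eq_fintype_card, Fintype.card_fun, ZMod.card, Fintype.card_fin]
    exact dvd_pow_self p (by omega)
  have h0 : (0 : Fin m → ZMod p) ∈ MulAction.fixedPoints N (Fin m → ZMod p) := by
    intro n
    exact Matrix.mulVec_zero _
  obtain ⟨v, hv, hv0⟩ := hN.exists_fixed_point_of_prime_dvd_card_of_fixed_point _ hcard h0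
  rw [Submodule.ne_bot_iff]
  refine ⟨v, ?_, fun h => hv0 h.symm⟩
  intro n hn
  exact hv ⟨n, hn⟩

/-- **Proper**: a non-trivial subgroup moves some vector. -/
theorem fixN_ne_top (N : Subgroup (GLm p m)) (hN : N ≠ ⊥) : fixN N ≠ ⊤ := by
  obtain ⟨n, hn1⟩ := (Subgroup.ne_bot_iff_exists_ne_one).mp hN
  intro htop
  apply hn1
  have hall : ∀ v : Fin m → ZMod p, ((n : GLm p m) : Mat p m) *ᵥ v = v := fun v =>
    (mem_fixN.mp (htop ▸ Submodule.mem_top : v ∈ fixN N)) n n.2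
  have hmat : ((n : GLm p m) : Mat p m) = 1 := by
    apply Matrix.toLin'.injective
    refine LinearMap.ext fun v => ?_
    rw [Matrix.toLin'_apply, Matrix.toLin'_apply, hall, Matrix.one_mulVec]
  exact Subtype.ext (Units.ext hmat)

/-- **Invariant**: if `H` normalises `N` then `Fix(N)` is `H`-invariant. -/
theorem fixN_invariant {N H : Subgroup (GLm p m)} (hHN : ∀ h ∈ H, ∀ n ∈ N, h * n * h⁻¹ ∈ N)
    {h : GLm p m} (hh : h ∈ H) {v : Fin m → ZMod p} (hv : v ∈ fixN N) :
    (h : Mat p m) *ᵥ v ∈ fixN N := by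
  intro n hn
  have hn' : h⁻¹ * n * h⁻¹⁻¹ ∈ N := hHN h⁻¹ (H.inv_mem hh) n hn
  rw [inv_inv] at hn'
  have key : (n : GLm p m) = h * (h⁻¹ * n * h) * h⁻¹ := by group
  calc ((n : GLm p m) : Mat p m) *ᵥ ((h : Mat p m) *ᵥ v)
      = (((h * (h⁻¹ * n * h) * h⁻¹) * h : GLm p m) : Mat p m) *ᵥ v := by
        rw [Matrix.mulVec_mulVec, ← key, Units.val_mul]
    _ = ((h * (h⁻¹ * n * h) : GLm p m) : Mat p m) *ᵥ v := by rw [inv_mul_cancel_right]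
    _ = (h : Mat p m) *ᵥ (((h⁻¹ * n * h : GLm p m) : Mat p m) *ᵥ v) := by
        rw [Units.val_mul, ← Matrix.mulVec_mulVec]
    _ = (h : Mat p m) *ᵥ v := by rw [hv _ hn']

/-- **REDUCIBILITY.**  If `H ≤ GL_m(𝔽_p)` (`m ≥ 1`) normalises a non-trivial `p`-subgroup `N`, then
`H` leaves invariant a proper non-zero subspace (namely `Fix(N)`): `H` lies in a proper parabolic. -/
theorem exists_invariant_of_normal_pGroup (hm : 1 ≤ m) {N H : Subgroup (GLm p m)}
    (hN : IsPGroup p N) (hN1 : N ≠ ⊥) (hHN : ∀ h ∈ H, ∀ n ∈ N, h * n * h⁻¹ ∈ N) :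
    ∃ W : Submodule (ZMod p) (Fin m → ZMod p), W ≠ ⊥ ∧ W ≠ ⊤ ∧
      ∀ h ∈ H, ∀ v ∈ W, (h : Mat p m) *ᵥ v ∈ W :=
  ⟨fixN N, fixN_ne_bot hm N hN, fixN_ne_top N hN1, fun _ hh _ hv => fixN_invariant hHN hh hv⟩

/-- **Normal Sylow ⇒ reducible.**  If `p ∣ |H|` and the Sylow `p`-subgroup `P` of `H ≤ GL_m(𝔽_p)` is
normal, then `H` leaves invariant a proper non-zero subspace. -/
theorem exists_invariant_of_sylow_normal (hm : 1 ≤ m) (H : Subgroup (GLm p m)) (P : Sylow p H)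
    (hP : (P : Subgroup H).Normal) (hdvd : p ∣ Nat.card H) :
    ∃ W : Submodule (ZMod p) (Fin m → ZMod p), W ≠ ⊥ ∧ W ≠ ⊤ ∧
      ∀ h ∈ H, ∀ v ∈ W, (h : Mat p m) *ᵥ v ∈ W := by
  have hNp : IsPGroup p ((P : Subgroup H).map H.subtype) := P.isPGroup'.map H.subtype
  have hcardP : 1 < Nat.card P := by
    rw [P.card_eq_multiplicity]
    have hpos : 0 < (Nat.card H).factorization p :=
      hp.out.factorization_pos_of_dvd Nat.card_pos.ne' hdvd
    exact Nat.one_lt_pow hpos.ne' hp.out.one_lt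
  have hN1 : (P : Subgroup H).map H.subtype ≠ ⊥ := by
    intro hbot
    have hc : Nat.card ((P : Subgroup H).map H.subtype) = Nat.card P :=
      Subgroup.card_map_of_injective H.subtype_injective
    have h1 : Nat.card ((P : Subgroup H).map H.subtype) = 1 := by
      rw [hbot]; exact Subgroup.card_bot
    omega
  have hHN : ∀ h ∈ H, ∀ n ∈ (P : Subgroup H).map H.subtype,
      h * n * h⁻¹ ∈ (P : Subgroup H).map H.subtype := by
    intro h hh n hn
    obtain ⟨n', hn', hn'eq⟩ := Subgroup.mem_map.mp hn
    have hg : (⟨h, hh⟩ : H) * n' * (⟨h, hh⟩ : H)⁻¹ ∈ (P : Subgroup H) := hP.conj_mem n' hn' ⟨h, hh⟩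
    refine Subgroup.mem_map.mpr ⟨_, hg, ?_⟩
    rw [← hn'eq]
    rfl
  exact exists_invariant_of_normal_pGroup hm hNp hN1 hHN

end Fixed

/-! ## 3. Crux forms: the members of a level-one witness -/

section Crux

variable {p : ℕ} [hp : Fact p.Prime] {l : ℕ}
variable {H₁ H₂ H₃ : Subgroup (GLm p (1 + l))}

/-- **NORMAL-SYLOW LAW for a member** (from the window `|H| + 3 ≤ p^{1+l}`): every Sylow
`p`-subgroup `P` of `H` is normal in `H` or satisfies `|P| · p² ≤ p^{1+l}`. -/
theorem sylow_normal_or_small (H : Subgroup (GLm p (1 + l))) (hH : Nat.card H + 3 ≤ p ^ (1 + l))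
    (P : Sylow p H) : (P : Subgroup H).Normal ∨ Nat.card P * p ^ 2 ≤ p ^ (1 + l) := by
  by_cases hPN : (P : Subgroup H).Normal
  · exact Or.inl hPN
  · exact Or.inr (card_sylow_mul_sq_le P hPN (by omega))

/-- **CRUX FORM (all three members).**  For a subgroup-TPP triple of `GL_{1+l}(𝔽_p)` (`p ≥ 3`, `l ≥ 1`)
carrying a level-one identity design and satisfying the crux inequality with `−2 < ε ≤ 1`: for each
member `Hᵢ` and each Sylow `p`-subgroup `P` of `Hᵢ`, `P ⊴ Hᵢ` or `|P| · p² ≤ p^{1+l}`. -/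
theorem crux_sylow (hl : 1 ≤ l) (hp3 : 3 ≤ p) {ε : ℝ} (hε : -2 < ε) (hε1 : ε ≤ 1)
    (htpp : SubgroupTPP H₁ H₂ H₃)
    (hdes : ∃ c : Mat p (1 + l) → ℂ, (∀ M, 1 < M.rank → c M = 0) ∧
      (∑ M, c M * ZMod.stdAddChar (Matrix.trace (M * ((1 : GLm p (1 + l)) : Mat p (1 + l))))) = 1 ∧
      ∀ a ∈ H₁, ∀ b ∈ H₂, ∀ g ∈ H₃, a * b * g ≠ 1 →
        (∑ M, c M * ZMod.stdAddChar
          (Matrix.trace (M * ((a * b * g : GLm p (1 + l)) : Mat p (1 + l))))) = 0)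
    (hlt : budget p (1 + l) 1 (2 + ε) <
      ((Nat.card H₁ * Nat.card H₂ * Nat.card H₃ : ℕ) : ℝ) ^ ((2 + ε) / 3)) :
    (∀ P : Sylow p H₁, (P : Subgroup H₁).Normal ∨ Nat.card P * p ^ 2 ≤ p ^ (1 + l)) ∧
      (∀ P : Sylow p H₂, (P : Subgroup H₂).Normal ∨ Nat.card P * p ^ 2 ≤ p ^ (1 + l)) ∧
      (∀ P : Sylow p H₃, (P : Subgroup H₃).Normal ∨ Nat.card P * p ^ 2 ≤ p ^ (1 + l)) := by
  obtain ⟨⟨-, hxu, -⟩, ⟨-, hyu⟩, ⟨-, hzu, -⟩⟩ := levelOne_member_window hl hp3 hε hε1 htpp hdes hlt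
  exact ⟨fun P => sylow_normal_or_small H₁ hxu P, fun P => sylow_normal_or_small H₂ hyu P,
    fun P => sylow_normal_or_small H₃ hzu P⟩

/-- **CRUX FORM (reducibility).**  Under the same hypotheses: a member `Hᵢ` with `p ∣ |Hᵢ|` whose
Sylow `p`-subgroup is normal leaves invariant a proper non-zero subspace of `𝔽_p^{1+l}`; so every
member with `p ∣ |Hᵢ|` is REDUCIBLE or has a non-normal Sylow `p`-subgroup of order `≤ p^{l−1}`. -/
theorem crux_reducible_or_small (hl : 1 ≤ l) (hp3 : 3 ≤ p) {ε : ℝ} (hε : -2 < ε) (hε1 : ε ≤ 1)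
    (htpp : SubgroupTPP H₁ H₂ H₃)
    (hdes : ∃ c : Mat p (1 + l) → ℂ, (∀ M, 1 < M.rank → c M = 0) ∧
      (∑ M, c M * ZMod.stdAddChar (Matrix.trace (M * ((1 : GLm p (1 + l)) : Mat p (1 + l))))) = 1 ∧
      ∀ a ∈ H₁, ∀ b ∈ H₂, ∀ g ∈ H₃, a * b * g ≠ 1 →
        (∑ M, c M * ZMod.stdAddChar
          (Matrix.trace (M * ((a * b * g : GLm p (1 + l)) : Mat p (1 + l))))) = 0)
    (hlt : budget p (1 + l) 1 (2 + ε) <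
      ((Nat.card H₁ * Nat.card H₂ * Nat.card H₃ : ℕ) : ℝ) ^ ((2 + ε) / 3))
    (H : Subgroup (GLm p (1 + l))) (hH : H = H₁ ∨ H = H₂ ∨ H = H₃) (hdvd : p ∣ Nat.card H)
    (P : Sylow p H) :
    (∃ W : Submodule (ZMod p) (Fin (1 + l) → ZMod p), W ≠ ⊥ ∧ W ≠ ⊤ ∧
        ∀ h ∈ H, ∀ v ∈ W, (h : Mat p (1 + l)) *ᵥ v ∈ W) ∨
      (¬ (P : Subgroup H).Normal ∧ Nat.card P * p ^ 2 ≤ p ^ (1 + l)) := by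
  obtain ⟨⟨-, hxu, -⟩, ⟨-, hyu⟩, ⟨-, hzu, -⟩⟩ := levelOne_member_window hl hp3 hε hε1 htpp hdes hlt
  have hHu : Nat.card H + 3 ≤ p ^ (1 + l) := by
    rcases hH with rfl | rfl | rfl
    · exact hxu
    · exact hyu
    · exact hzu
  by_cases hPN : (P : Subgroup H).Normal
  · exact Or.inl (exists_invariant_of_sylow_normal (by omega) H P hPN hdvd)
  · exact Or.inr ⟨hPN, card_sylow_mul_sq_le P hPN (by omega)⟩

/-- `|P|·p² ≤ p³` means `|P| ≤ p`. -/
theorem le_of_mul_sq_le_cube {P p : ℕ} (hp : 0 < p) (h : P * p ^ 2 ≤ p ^ 3) : P ≤ p := by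
  have h' : P * p ^ 2 ≤ p * p ^ 2 := by
    calc P * p ^ 2 ≤ p ^ 3 := h
      _ = p * p ^ 2 := by ring
  exact Nat.le_of_mul_le_mul_right h' (by positivity)

/-- **THE CASE `m = 3`.**  For a subgroup-TPP triple of `GL₃(𝔽_p)` (`p ≥ 3`) carrying a level-one
identity design and satisfying the crux inequality with `−2 < ε ≤ 1`: every Sylow `p`-subgroup of
every member is NORMAL in that member or has order at most `p`.  (So `|Hᵢ|_p = p²` forces a normal
Sylow `p`-subgroup and, by `crux_reducible_or_small`, a reducible member.) -/
theorem crux_sylow_three (hp3 : 3 ≤ p) {ε : ℝ} (hε : -2 < ε) (hε1 : ε ≤ 1)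
    {H₁ H₂ H₃ : Subgroup (GLm p 3)} (htpp : SubgroupTPP H₁ H₂ H₃)
    (hdes : ∃ c : Mat p 3 → ℂ, (∀ M, 1 < M.rank → c M = 0) ∧
      (∑ M, c M * ZMod.stdAddChar (Matrix.trace (M * ((1 : GLm p 3) : Mat p 3)))) = 1 ∧
      ∀ a ∈ H₁, ∀ b ∈ H₂, ∀ g ∈ H₃, a * b * g ≠ 1 →
        (∑ M, c M * ZMod.stdAddChar (Matrix.trace (M * ((a * b * g : GLm p 3) : Mat p 3)))) = 0)
    (hlt : budget p 3 1 (2 + ε) < ((Nat.card H₁ * Nat.card H₂ * Nat.card H₃ : ℕ) : ℝ) ^ ((2 + ε) / 3)) :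
    (∀ P : Sylow p H₁, (P : Subgroup H₁).Normal ∨ Nat.card P ≤ p) ∧
      (∀ P : Sylow p H₂, (P : Subgroup H₂).Normal ∨ Nat.card P ≤ p) ∧
      (∀ P : Sylow p H₃, (P : Subgroup H₃).Normal ∨ Nat.card P ≤ p) := by
  have hp0 : 0 < p := by omega
  obtain ⟨h1, h2, h3⟩ := crux_sylow (l := 2) (by norm_num) hp3 hε hε1 htpp hdes hlt
  refine ⟨fun P => ?_, fun P => ?_, fun P => ?_⟩
  · exact (h1 P).imp_right (le_of_mul_sq_le_cube hp0)
  · exact (h2 P).imp_right (le_of_mul_sq_le_cube hp0)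
  · exact (h3 P).imp_right (le_of_mul_sq_le_cube hp0)

end Crux

end NormalSylowLaw
end Summit.MatrixMultiplication.MatrixMultiplication.Theorems.SubgroupIdentityDesigns.Negative

end
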